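import Summits.QuantumFields.YangMills.Theorems.BalabanUVNodesN05SubBP2CSlotGammaPrime
import Literature.MathematicalPhysics.QuantumFieldTheory.Balaban1983to89.B8Prop6PrintedZdCubPGamma

/-!
# BalabanUVNodes ∕ N05 ([Balaban1985RegularSpaces] Lemma 1 p. 79 – Thm 8 p. 101): THE RE-PINNED SLOT IS INHABITED FOR *SOME* RESIDUAL LAYER — THE FOUR-PIN ENGINE'S
# N05 ROW `h05 ↦ ∃ lam8, B8LeafOfRecordSubBP₂C θ₃ lam8` («P₂C» edition) FROM THE [4]-TYPE SOCKETS ALONE: Theorem 8's layer equations, its auxiliary constants and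
# guards, the Proposition-5 free-constant guard, the Proposition-6 witness clause and the dial of p606531's ★★★ are DISCHARGED BY CHOICE OF THE LAYER (arithmetic) and by
# dag-n05-e's p596570

Track A of `YM-PLAN.md` (cell `pub-ymgap`, HUMAN RULING D-0062), node **N05**; seat `pub-ymgap-dag-n05-d` (g12), 2026-08-28; bears on K1⁷ `stmt-QuantumFields-20542`
(`--supports … --as helper`, count-neutral).

WHY.  `BalabanUVNodesN05SubBP2CSlotGammaPrime.b8LeafOfRecordSubBP₂C_cutSubBP_zdLan_printCube_of_knit_lettersSrc_γ'` (p606531) inhabits NODE 00's re-pinned slot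
`Node00.CarriersB8SubBP2C.B8LeafOfRecordSubBP₂C θ λ′` at the NAMED layer `λ′ = λ.cutSubBP J (zdLan θ.L λ.B₁ ∘ ι) c₁⋆ ρ₀` of a GIVEN residual layer `λ`, and therefore
displays, besides the [Balaban1985BackgroundPropagators]-type sockets ∕ letters (N06 content), a block of pure BOOKKEEPING about `λ`'s constants: Theorem 8's layer
equations `λ.B₁′ = 5dLB₈`, `λ.B₁ = 5dLB₈(1+11d²)`, `λ.B₂ = 5dLB₈(β₀)(1+11d²)`, Proposition 3's `λ.C₂ = 2²¹(d+1)²L²`, the guards `B₀ ≤ B₈`, `5dLB₀ + 2γ′B₀ ≤ 5dLB₈`,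
`5dLB₀ + 2γ″B₀ ≤ 5dLB₈`, `5dLB₀(β₀) + 2B₀(β₀)γ″B₀ + γβ ≤ 5dLB₈(β₀)`, the free-constant guards `3(2dL²)·BG·BR·(B₈+γ₈) ≤ B₀′B₈`, `3(2dL²)·BG·BR ≤ B₀′∕2`, the θ-level
Proposition-6 witness clause `hP6` and the dial `B₁⋆ ≤ λ.B₁`.  At a Stage-13 record the residual [B8] layer is CHOSEN (dag-n05-w1's ∃-currency entry point
`Node00.isRecordOfRecord₁₃CSepSB8subBP₂C_rebind_of_isRecordOfRecord₁₃CSep`, p605609; the four-pin engine's N05 row reads `∃ lam8, B8LeafOfRecordSubBP₂C θ₃ lam8` in the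
SC-keyed edition, dag-n24-c ∕ dag-n05-w4), so every one of these is dischargeable by ARITHMETIC once the [4]-side constants are given:
`B₈ := B₀ + γ₈ + B₁⋆ + 2(γ′+γ″)B₀∕(5dL)`, `B₈(β₀) := B₀(β₀) + (2B₀(β₀)γ″B₀ + γβ)∕(5dL)`, `B₀′ := 2K + 1` with `K := 3(2dL²)·BG·BR`, `C₂ := 2²¹(d+1)²L²`, `c₁ := 0`,
`(ρ₀, B₁⋆, c₁⋆)` := dag-n05-e's `B8Prop6PrintedZdCubPGamma.prop6Printed_zdCubP_γ_holds_record_dvd θ hD hL5` (p596570: Proposition 6 AS PRINTED on print's cube class for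
`d ≥ 2`, odd `L ≥ 5`).  The ONE change of socket TEXT: Theorem 3.3-with-source at (1.146) (`SH59src`) is asked RADIUS-UNIFORMLY — «for every gauge-field radius scale
`r ≥ 0` there is a threshold `c59 > 0` such that … `‖A′(y,τ)‖ ≤ r(α₀+α₁)(Lʲη)⁻¹` …» — because the radius print needs, `2L·5dLB₈ + 64B₀′·5dLB₈`, now depends on the
CHOSEN `B₈, B₀′`; [4]'s Theorem 3.3 is uniform in this sense (its threshold shrinks with the radius), and p606531's fixed-radius socket is the instance `r := …` (declared;
nothing of [4] asserted).  Every other socket ∕ letter is p606531's VERBATIM with `λ.inp.B₀ ∕ λ.B₀(β₀) ∕ λ.β ∕ λ.len` read as the primitive constants `B₀ ∕ B₀β ∕ β ∕ len`.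

WHAT IS PROVED (one theorem; arithmetic + `obtain` + ONE `exact` of p606531; no estimate; no new definition):
* ★★★ **`exists_residB8_b8LeafOfRecordSubBP₂C_of_lettersSrc_γ'`** — for `θ : Node00.Stage3Params` with `2 ≤ θ.D`, `5 ≤ θ.L`: [4]'s primitive constants with
  positivity guards and `2 ≤ 5dLB₀`; [4]'s letters `SLet ∕ SLetUB` and the b9 sockets `SB9P` (sourceless, Prop. 3's frame, both-points Hölder line), `SH59src`
  (radius-uniform, Thm 4's frame at (1.146)), `SB9srcHP` (sourced, Prop. 3's frame) at the COLLAR LAW MEMBERS (`Ω₀ = ℤᵈ`, `IdxB8LawsB`, `DomainSeq`); Proposition 5's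
  `zdLan` members `ι : J → ZdLanIdx` with their laws and [4]'s letters `SLetL ∕ SLetLU` ⊢ **`∃ lam : ResidB8 θ, B8LeafOfRecordSubBP₂C θ lam`**.
HONEST FRAMING: bookkeeping eliminated, nothing else; 0 estimates; the sockets ∕ letters are HYPOTHESES (N06 content; `m ≥ 1` OPEN; NOT claimed); Proposition 7 inside the
slot is the repaired currency `c₇OfRecord θ = 530·D·L²` (WATCH-P7-CURRENCY-RECORD, dag-n05-w2 ∕ w5 necessity certificates p605631 ∕ p607226); the record's booking is the
planners' ∕ chair's; count-neutral; **N05 NOT discharged**; Bałaban AS PRINTED with locators; one finite 𝕋⁴ programme at fixed ε; nothing continuum ∕ ℝ⁴ ∕ OS ∕ mass-gap ∕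
Clay.  No `sorry`, no new definition.  Unit `pub-ymgap-dag-n05-d` (g12), 2026-08-28.
[cite: Balaban1985RegularSpaces, Lemma 1 p.79, Thm 2 p.83, Prop. 3 p.87, Thm 4 p.88, Prop. 5 (1.106)–(1.110) p.94, Prop. 6 (1.135)–(1.138) p.99, p.98, Prop. 7 (1.144)–(1.145) p.100, Thm 8 (1.146) p.101, (1.3)–(1.4) p.77; Balaban1985BackgroundPropagators, Thm 3.1 p.397, Thm 3.3 p.398, (3.40) p.397]
-/

noncomputable section

namespace Summit.QuantumFields.YangMills.BalabanUVNodes.N05SubBP2CSlotExistsGammaPrime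

open Literature.MathematicalPhysics.QuantumFieldTheory.Balaban1983to89
open Literature.MathematicalPhysics.QuantumFieldTheory.Balaban1983to89.Node00
open Literature.MathematicalPhysics.QuantumFieldTheory.Balaban1983to89.B8IdxB8LawsB (IdxB8LawsB IdxB8SubB)
open Literature.MathematicalPhysics.QuantumFieldTheory.Balaban1983to89.B8LeafModelZd (ZdIdx)
open Literature.MathematicalPhysics.QuantumFieldTheory.Balaban1983to89.B8LeafModelZd3 (SockB9P3)
open Literature.MathematicalPhysics.QuantumFieldTheory.Balaban1983to89.B9SupplySockB9P3ZdGammaUnivDelta2 (SockB9P3H2)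
open Literature.MathematicalPhysics.QuantumFieldTheory.Balaban1983to89.B8LeafModelZd3P (zdGF3P zdGF3HP)
open Literature.MathematicalPhysics.QuantumFieldTheory.Balaban1983to89.B8LeafModelZd3P2 (zdGF3P₂ zdGF3HP₂)
open Literature.MathematicalPhysics.QuantumFieldTheory.Balaban1983to89.B8LeafKnitRSC (B8LeafRSC)
open Literature.MathematicalPhysics.QuantumFieldTheory.Balaban1983to89.B8Prop7TowerAxialRecord (toAxialTowerResid)
open Literature.MathematicalPhysics.QuantumFieldTheory.Balaban1983to89.B8TowerBondsPrinted (towerBondsP)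
open Literature.MathematicalPhysics.QuantumFieldTheory.Balaban1983to89.B8SockLettersRD (SockLettersRD)
open Literature.MathematicalPhysics.QuantumFieldTheory.Balaban1983to89.B8Lemma1NonAbelian (mulCfg blockPairNA)
open Literature.MathematicalPhysics.QuantumFieldTheory.Balaban1983to89.B8LanF146 (LanF146 lanF146_zero_iff)
open Literature.MathematicalPhysics.QuantumFieldTheory.Balaban1983to89.B8Eq138LandauZd (covLap QT InR138 IsLandau146W inR138_zero)
open Literature.MathematicalPhysics.QuantumFieldTheory.Balaban1983to89.B8Prop5LandauDataZd (ZdLanIdx zdLan)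
open Literature.MathematicalPhysics.QuantumFieldTheory.Balaban1983to89.B8Prop6PrintedZdCubPGamma (prop6Printed_zdCubP_γ_holds_record_dvd)
open MatrixLog B7Prop1Explicit B7Prop2Explicit B7Prop1Local B7Eq92Concrete
open B8Ineq130 (tlo thi)
open B8Ineq132 (InAk covDerivFwd)
open B7Eq78Linearization (zdBlocking QprimeIter)
open B8Eq119TwistedAxial (bgT Restr129 InAx)
open B8Eq140Level (SideTouches)
open B8Eq1117Concrete (XSpace)
open B8Prop5ContractionKLevel (Bd2)
open B8LambdaSpaceKLevel (wt)
open B8Eq184Proof (gaugeExp cfgExp)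
open B8Eq146AExpansion (iEta plaqCovDeriv)
open B8Eq143PlaqExpansion (pdiv)
open B7Prop4GeneralLevels (linCovIter)
open B8Eq155JBound (Jcur wsup)
open B8ScaledSupNorm (bondNorm msup Bdd msup_le bdd_of_forall)
open B9Eq340HolderZd (hquot AdmPair)
open Summit.QuantumFields.YangMills.BalabanUVNodes.N05SubBP2CSlotGammaPrime (b8LeafOfRecordSubBP₂C_cutSubBP_zdLan_printCube_of_knit_lettersSrc_γ')

-- `Site` alone could resolve to the torus sites of `Setup.lean`; re-export the `ℤ^d` sites of `B7Prop1Explicit`.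
export B7Prop1Explicit (Site)

/-! ### Arithmetic of the chosen constants (plain real numbers; kept out of the socket-laden main context) -/

/-- `1 ≤ 5dL` and `0 < 5dL` for `d ≥ 2`, `L ≥ 5`. [cite: Balaban1985RegularSpaces, Prop. 3 p.87 (the constant `5dL`, bookkeeping)] -/
private theorem fiveDL_bounds {D L : ℝ} (hD : 2 ≤ D) (hL : 5 ≤ L) : 1 ≤ 5 * D * L ∧ 0 < 5 * D * L := by
  constructor <;> nlinarith

/-- `2 ≤ M·B₀` with `M > 0` forces `B₀ > 0`. [cite: Balaban1985BackgroundPropagators, (3.40) p.397 (the constant `B₀`, bookkeeping)] -/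
private theorem pos_of_two_le_mul {M B₀ : ℝ} (hM : 0 < M) (h : 2 ≤ M * B₀) : 0 < B₀ := by
  by_contra h'
  have : M * B₀ ≤ 0 := mul_nonpos_of_nonneg_of_nonpos hM.le (not_lt.1 h')
  linarith

/-- THE CHOICE OF THEOREM 8's AUXILIARY CONSTANT `B₈ := B₀ + γ₈ + B₁⋆ + 2(γ′+γ″)B₀∕M` (`M = 5dL ≥ 1`, `E = 1 + 11d² ≥ 1`): it dominates `B₀`, `γ₈`, leaves room
for the slacks `γ′`, `γ″`, and `B₁⋆ ≤ M·B₈·E`. [cite: Balaban1985RegularSpaces, Thm 8 (1.146) p.101, Prop. 3 p.87 (shape of the constants, bookkeeping)] -/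
private theorem exists_B₈ {M E B₀ γ₈ B₁s γ' γ'' : ℝ} (hM : 1 ≤ M) (hE : 1 ≤ E) (hB₀ : 0 < B₀) (hγ₈ : 1 ≤ γ₈) (hγ' : 0 ≤ γ') (hγ'' : 0 ≤ γ'')
    (hB₁s : 0 < B₁s) :
    ∃ B₈ : ℝ, 0 ≤ B₈ ∧ B₀ ≤ B₈ ∧ γ₈ ≤ B₈ ∧ M * B₀ + 2 * (γ' * B₀) ≤ M * B₈ ∧ M * B₀ + 2 * (γ'' * B₀) ≤ M * B₈ ∧ B₁s ≤ M * B₈ * E := by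
  have hM0 : 0 < M := lt_of_lt_of_le one_pos hM
  have h1 : 0 ≤ γ' * B₀ := mul_nonneg hγ' hB₀.le
  have h2 : 0 ≤ γ'' * B₀ := mul_nonneg hγ'' hB₀.le
  have h3 : 0 ≤ 2 * ((γ' + γ'') * B₀) / M := by positivity
  have h4 : M * (B₀ + γ₈ + B₁s + 2 * ((γ' + γ'') * B₀) / M) = M * B₀ + M * γ₈ + M * B₁s + 2 * ((γ' + γ'') * B₀) := by
    field_simp
  have h5 : γ₈ ≤ M * γ₈ := by nlinarith
  have h6 : B₁s ≤ M * B₁s := by nlinarith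
  refine ⟨B₀ + γ₈ + B₁s + 2 * ((γ' + γ'') * B₀) / M, by linarith, by linarith, by linarith, ?_, ?_, ?_⟩
  · rw [h4]; nlinarith
  · rw [h4]; nlinarith
  · have h7 : 0 ≤ M * (B₀ + γ₈ + B₁s + 2 * ((γ' + γ'') * B₀) / M) := by rw [h4]; nlinarith
    have h8 : M * (B₀ + γ₈ + B₁s + 2 * ((γ' + γ'') * B₀) / M) ≤ M * (B₀ + γ₈ + B₁s + 2 * ((γ' + γ'') * B₀) / M) * E :=
      le_mul_of_one_le_right h7 hE
    rw [h4] at h8 ⊢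
    nlinarith

/-- THE CHOICE OF THEOREM 8's AUXILIARY HÖLDER CONSTANT `B₈(β₀) := B₀(β₀) + (2B₀(β₀)γ″B₀ + γβ)∕M`. [cite: Balaban1985RegularSpaces, Thm 8 (1.146) p.101 (bookkeeping)] -/
private theorem exists_B₈β {M B₀β γ'' B₀ γβ : ℝ} (hM : 0 < M) : ∃ B₈β : ℝ, M * B₀β + 2 * B₀β * (γ'' * B₀) + γβ ≤ M * B₈β :=
  ⟨B₀β + (2 * B₀β * (γ'' * B₀) + γβ) / M, le_of_eq (by rw [mul_add, mul_div_cancel₀ _ hM.ne', add_assoc])⟩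

/-- THE CHOICE OF PROPOSITION 5's `B₀′ := 2K + 1` (`K = 3(2dL²)·BG·BR ≥ 0`): both free-constant guards hold once `γ₈ ≤ B₈`.
[cite: Balaban1985RegularSpaces, Prop. 5 (1.101)–(1.105) p.94 (the constant `B₀′`, bookkeeping)] -/
private theorem free_guards {K γ₈ B₈ : ℝ} (hK : 0 ≤ K) (h : γ₈ ≤ B₈) (hB₈ : 0 ≤ B₈) :
    K ≤ (2 * K + 1) / 2 ∧ K * (B₈ + γ₈) ≤ (2 * K + 1) * B₈ := by
  refine ⟨by linarith, ?_⟩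
  have h1 : K * γ₈ ≤ K * B₈ := mul_le_mul_of_nonneg_left h hK
  nlinarith

/-- Theorem 8's gauge-field radius `2L·(M B₈) + 64B₀′·(M B₈)` is non-negative. [cite: Balaban1985RegularSpaces, Thm 8 (1.146) p.101 (bookkeeping)] -/
private theorem radius_nonneg {L M B₈ B₀' : ℝ} (hL : 0 ≤ L) (hM : 0 ≤ M) (hB₈ : 0 ≤ B₈) (hB₀' : 0 ≤ B₀') :
    0 ≤ 2 * (L * (M * B₈)) + 8 * (8 * B₀' * (M * B₈)) := by positivity

section SlotExists

/-- ★★★ **THE RE-PINNED SLOT IS INHABITED FOR SOME RESIDUAL LAYER — THE ENGINE ROW `h05 ↦ ∃ lam8, B8LeafOfRecordSubBP₂C θ₃ lam8` FROM THE [4]-TYPE SOCKETS ALONE.**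
For `θ` with `2 ≤ θ.D`, `5 ≤ θ.L`: given [Balaban1985BackgroundPropagators]'s primitive constants (positivity guards, `2 ≤ 5dLB₀`), its letters `SLet ∕ SLetUB` and the three
b9 sockets `SB9P ∕ SH59src ∕ SB9srcHP` at the collar law members (texts of p606531; `SH59src` radius-uniform), and Proposition 5's `zdLan` members with their letters
`SLetL ∕ SLetLU`, THERE IS a residual [B8] layer `lam` with `B8LeafOfRecordSubBP₂C θ lam`.  Proof: `(ρ₀, B₁⋆, c₁⋆)` from `prop6Printed_zdCubP_γ_holds_record_dvd` (p596570);
choose `B₈ := B₀ + γ₈ + B₁⋆ + 2(γ′+γ″)B₀∕(5dL)`, `B₈β := B₀β + (2B₀βγ″B₀ + γβ)∕(5dL)`, `B₀′ := 2·3(2dL²)BG·BR + 1`, the layer with Theorem 8's constants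
`B₁′ := 5dLB₈`, `B₁ := 5dLB₈(1+11d²)`, `B₂ := 5dLB₈β(1+11d²)`, `C₂ := 2²¹(d+1)²L²`; instantiate `SH59src` at `r := 2L·5dLB₈ + 64B₀′·5dLB₈`; ONE `exact` of p606531's
`b8LeafOfRecordSubBP₂C_cutSubBP_zdLan_printCube_of_knit_lettersSrc_γ'` at `lam.cutSubBP J (zdLan θ.L lam.B₁ ∘ ι) c₁⋆ ρ₀`.  Sockets ∕ letters are HYPOTHESES (N06); N05 NOT
discharged. [cite: Balaban1985RegularSpaces, Lemma 1 – Thm 8 pp.79–101, Prop. 6 (1.135)–(1.138) p.99, p.98, Thm 8 (1.146) p.101 (constants `B₁ = 5dLB₀(1+11d²)`-shape p.87 L22–34); Balaban1985BackgroundPropagators, Thm 3.1 p.397, Thm 3.3 p.398, (3.40) p.397] -/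
theorem exists_residB8_b8LeafOfRecordSubBP₂C_of_lettersSrc_γ' (θ : Stage3Params) (hD : 2 ≤ θ.D) (hL5 : 5 ≤ θ.L)
    -- [Balaban1985BackgroundPropagators]'s PRIMITIVE constants read by the sockets: `B₀` (3.40), the Hölder pair `(β, B₀(β₀))` and length function, [4]'s letter bounds
    {B₀ B₀β β : ℝ} {len : Site θ.D → ℝ}
    {cB9 B₀'H B₂' BG BR cL : ℝ}
    (hcB9 : 0 < cB9) (hB₀'H : 0 < B₀'H) (hB₂' : 0 ≤ B₂') (hBG : 0 ≤ BG) (hBR : 0 ≤ BR) (hcL : 0 < cL)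
    -- [4]'s letters AT THE `Ω₀ = ℤᵈ` LAW MEMBERS ONLY: existence side (laws on print's domains) and uniqueness side
    (SLet : ∀ i : ZdIdx θ.D θ.L, i.Ω 0 = Set.univ → IdxB8LawsB θ.L i → B8ConstraintBonds.DomainSeq θ.L i.Ω → SockLettersRD (𝔸 := θ.𝔸) θ.L BG BR B₀'H B₂' cL i.η i.k i.Ω i.Λs)
    (SLetUB : ∀ i : ZdIdx θ.D θ.L, i.Ω 0 = Set.univ → IdxB8LawsB θ.L i → B8ConstraintBonds.DomainSeq θ.L i.Ω → ∀ α₀ : ℝ, 0 < α₀ → α₀ ≤ cL → ∀ U₀ : Site θ.D → Fin θ.D → θ.𝔸ˣ, (∀ x κ, U₀ x κ ∈ unitaryUnits θ.𝔸) →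
      InAk θ.L i.k i.η α₀ i.Ω U₀ →
      ∃ (g Δ : (Site θ.D → θ.𝔸) →ₗ[ℂ] (Site θ.D → θ.𝔸)) (q : (Site θ.D → θ.𝔸) →ₗ[ℂ] (ℕ → Site θ.D → θ.𝔸))
        (qs : (ℕ → Site θ.D → θ.𝔸) →ₗ[ℂ] (Site θ.D → θ.𝔸)) (Aw c : (ℕ → Site θ.D → θ.𝔸) →ₗ[ℂ] (ℕ → Site θ.D → θ.𝔸))
        (H' : XSpace θ.D i.k θ.𝔸 →ₗ[ℂ] (Site θ.D → θ.𝔸)),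
        (∀ x : Site θ.D → θ.𝔸, (∃ C : ℝ, ∀ y, ‖x y‖ ≤ C) → g (Δ x + qs (Aw (q x))) = x) ∧ (∀ φ, qs (c (q (g (g (qs φ))))) = qs φ) ∧
        (∀ (f : Site θ.D → θ.𝔸), ∀ x ∈ i.Ω 0, Δ f x = covLap i.η U₀ ((i.Ω 0).indicator f) x) ∧
        (∀ (μ : ℕ → Site θ.D → θ.𝔸), ∀ x ∈ i.Ω 0, qs μ x = QT θ.L i.k (i.Λs i.k) U₀ μ x) ∧
        (∀ (f : Site θ.D → θ.𝔸) (n : ℕ), n ≤ i.k → ∀ y ∈ i.Λs i.k n, q f n y = QprimeIter (zdBlocking θ.D θ.L) (bgT θ.L U₀) n f y) ∧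
        (∀ (f : Site θ.D → θ.𝔸) (n : ℕ) (y : Site θ.D), ¬ (n ≤ i.k ∧ y ∈ i.Λs i.k n) → q f n y = 0) ∧
        (∀ (X : XSpace θ.D i.k θ.𝔸) (x : Site θ.D), ‖H' X x‖ ≤ B₀'H * ‖X‖) ∧
        (∀ n, n ≤ i.k → ∀ (X : XSpace θ.D i.k θ.𝔸), ∀ p ∈ {b : Site θ.D × Fin θ.D | SideTouches (i.Ω n) b.1 b.2},
          wt θ.L i.η n * ‖covDerivFwd i.η U₀ p.2 (H' X) p.1‖ ≤ B₀'H * ‖X‖) ∧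
        (∀ X : XSpace θ.D i.k θ.𝔸, Bd2 θ.L i.η i.k i.Ω (covLap i.η U₀ (H' X)) (B₂' * ‖X‖)) ∧
        (∀ (Y : XSpace θ.D i.k θ.𝔸) (n : ℕ) (hn : n ≤ i.k) (y : Site θ.D), y ∈ i.Λs i.k n →
          QprimeIter (zdBlocking θ.D θ.L) (bgT θ.L U₀) n (H' Y) y = Y (⟨n, Nat.lt_succ_of_le hn⟩, y)) ∧
        (∀ (f : Site θ.D → θ.𝔸) (r : ℝ), 0 ≤ r → Bd2 θ.L i.η i.k i.Ω f r →
          (∀ x, ‖g f x‖ ≤ BG * r) ∧ ∀ n, n ≤ i.k → ∀ p ∈ {b : Site θ.D × Fin θ.D | SideTouches (i.Ω n) b.1 b.2},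
            wt θ.L i.η n * ‖covDerivFwd i.η U₀ p.2 (g f) p.1‖ ≤ BG * r) ∧
        (∀ (f : Site θ.D → θ.𝔸) (r : ℝ), 0 ≤ r → Bd2 θ.L i.η i.k i.Ω f r → Bd2 θ.L i.η i.k i.Ω (f - g (qs (c (q (g f))))) (BR * r)))
    -- the SOURCELESS b9 socket of Proposition 3's frame over PRINT's class, at the law members only ([4] Thm 3.3; threshold `cB9`) — for Prop. 3 AS PRINTED
    (SB9P : ∀ i : ZdIdx θ.D θ.L, i.Ω 0 = Set.univ → IdxB8LawsB θ.L i → B8ConstraintBonds.DomainSeq θ.L i.Ω →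
      SockB9P3H2 (𝔸 := θ.𝔸) θ.L B₀ B₀β cB9 β len i.η i.k i.Ω i.Λs (fun m j => towerBondsP θ.L i.Ω (i.Λs m) j))
    -- PROPOSITION 5's INDEX READ AS OBJECTS: `zdLan` members obeying the member laws, with [4]'s letters at each (RD currency)
    {J : Type} (ι : J → ZdLanIdx θ.D θ.𝔸)
    (hΩ0L : ∀ a : J, (ι a).Ω 0 = Set.univ) (hΩL : ∀ a : J, ∀ j, (ι a).Ω (j + 1) ⊆ (ι a).Ω j)
    (htowerL : ∀ a : J, ∀ j, j ≤ (ι a).k → ∀ y ∈ (ι a).Λ j, ∀ x, InBox (tlo θ.L y j) (thi θ.L y j) x → x ∈ (ι a).Ω j)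
    (SLetL : ∀ a : J, ∀ α₀ : ℝ, 0 < α₀ → α₀ ≤ cL → InAk θ.L (ι a).k (ι a).η α₀ (ι a).Ω (ι a).U₀ →
      ∃ (g Δ : (Site θ.D → θ.𝔸) →ₗ[ℂ] (Site θ.D → θ.𝔸)) (q : (Site θ.D → θ.𝔸) →ₗ[ℂ] (ℕ → Site θ.D → θ.𝔸))
        (qs : (ℕ → Site θ.D → θ.𝔸) →ₗ[ℂ] (Site θ.D → θ.𝔸)) (Aw c : (ℕ → Site θ.D → θ.𝔸) →ₗ[ℂ] (ℕ → Site θ.D → θ.𝔸))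
        (H' : XSpace θ.D (ι a).k θ.𝔸 →ₗ[ℂ] (Site θ.D → θ.𝔸)),
        (∀ x, ∀ y ∈ (ι a).Ω 0, (Δ (g x) + qs (Aw (q (g x)))) y = x y) ∧ (∀ f, q (g (g (qs (c (q f))))) = q f) ∧
        (∀ (f : Site θ.D → θ.𝔸), ∀ x ∈ (ι a).Ω 0, Δ f x = covLap (ι a).η (ι a).U₀ (((ι a).Ω 0).indicator f) x) ∧
        (∀ (μ : ℕ → Site θ.D → θ.𝔸), ∀ x ∈ (ι a).Ω 0, qs μ x = QT θ.L (ι a).k (ι a).Λ (ι a).U₀ μ x) ∧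
        (∀ (f : Site θ.D → θ.𝔸) (j : ℕ), j ≤ (ι a).k → ∀ y ∈ (ι a).Λ j, q f j y = QprimeIter (zdBlocking θ.D θ.L) (bgT θ.L (ι a).U₀) j f y) ∧
        (∀ (X : XSpace θ.D (ι a).k θ.𝔸) (x : Site θ.D), ‖H' X x‖ ≤ B₀'H * ‖X‖) ∧
        (∀ j, j ≤ (ι a).k → ∀ (X : XSpace θ.D (ι a).k θ.𝔸), ∀ p ∈ {b : Site θ.D × Fin θ.D | SideTouches ((ι a).Ω j) b.1 b.2},
          wt θ.L (ι a).η j * ‖covDerivFwd (ι a).η (ι a).U₀ p.2 (H' X) p.1‖ ≤ B₀'H * ‖X‖) ∧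
        (∀ X : XSpace θ.D (ι a).k θ.𝔸, Bd2 θ.L (ι a).η (ι a).k (ι a).Ω (covLap (ι a).η (ι a).U₀ (H' X)) (B₂' * ‖X‖)) ∧
        (∀ (X : XSpace θ.D (ι a).k θ.𝔸) (x : Site θ.D), x ∉ (ι a).Ω 0 → H' X x = 0) ∧
        (∀ X Y : XSpace θ.D (ι a).k θ.𝔸, (∀ p, Y p = -star (X p)) → ∀ x, H' Y x = -star (H' X x)) ∧
        (∀ (Y : XSpace θ.D (ι a).k θ.𝔸) (j : ℕ) (hj : j ≤ (ι a).k) (y : Site θ.D), y ∈ (ι a).Λ j →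
          QprimeIter (zdBlocking θ.D θ.L) (bgT θ.L (ι a).U₀) j (H' Y) y = Y (⟨j, Nat.lt_succ_of_le hj⟩, y)) ∧
        (∀ (f : Site θ.D → θ.𝔸) (r : ℝ), 0 ≤ r → Bd2 θ.L (ι a).η (ι a).k (ι a).Ω f r →
          (∀ x, ‖g f x‖ ≤ BG * r) ∧ ∀ j, j ≤ (ι a).k → ∀ p ∈ {b : Site θ.D × Fin θ.D | SideTouches ((ι a).Ω j) b.1 b.2},
            wt θ.L (ι a).η j * ‖covDerivFwd (ι a).η (ι a).U₀ p.2 (g f) p.1‖ ≤ BG * r) ∧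
        (∀ (f : Site θ.D → θ.𝔸) (x : Site θ.D), x ∉ (ι a).Ω 0 → g f x = 0) ∧
        (∀ f : Site θ.D → θ.𝔸, (∀ j, j ≤ (ι a).k → ∀ x ∈ (ι a).Ω j, IsSelfAdjoint (f x)) → ∀ x, IsSelfAdjoint (g f x)) ∧
        (∀ (f : Site θ.D → θ.𝔸) (r : ℝ), 0 ≤ r → Bd2 θ.L (ι a).η (ι a).k (ι a).Ω f r →
          Bd2 θ.L (ι a).η (ι a).k (ι a).Ω (f - g (qs (c (q (g f))))) (BR * r)) ∧
        (∀ f : Site θ.D → θ.𝔸, (∀ j, j ≤ (ι a).k → ∀ x ∈ (ι a).Ω j, IsSelfAdjoint (f x)) →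
          ∀ j, j ≤ (ι a).k → ∀ x ∈ (ι a).Ω j, IsSelfAdjoint ((f - g (qs (c (q (g f))))) x)))
    -- [4]'s UNIQUENESS letters at the Prop-5 members (left-inverse law of G′ on bounded functions), for Prop. 5's uniqueness clause there
    (SLetLU : ∀ a : J, ∀ α₀ : ℝ, 0 < α₀ → α₀ ≤ cL → InAk θ.L (ι a).k (ι a).η α₀ (ι a).Ω (ι a).U₀ →
      ∃ (g Δ : (Site θ.D → θ.𝔸) →ₗ[ℂ] (Site θ.D → θ.𝔸)) (q : (Site θ.D → θ.𝔸) →ₗ[ℂ] (ℕ → Site θ.D → θ.𝔸)) (qs : (ℕ → Site θ.D → θ.𝔸) →ₗ[ℂ] (Site θ.D → θ.𝔸))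
        (Aw c : (ℕ → Site θ.D → θ.𝔸) →ₗ[ℂ] (ℕ → Site θ.D → θ.𝔸)) (H' : XSpace θ.D (ι a).k θ.𝔸 →ₗ[ℂ] (Site θ.D → θ.𝔸)),
        (∀ x : Site θ.D → θ.𝔸, (∃ C : ℝ, ∀ y, ‖x y‖ ≤ C) → g (Δ x + qs (Aw (q x))) = x) ∧ (∀ φ, qs (c (q (g (g (qs φ))))) = qs φ) ∧
        (∀ (f : Site θ.D → θ.𝔸), ∀ x ∈ (ι a).Ω 0, Δ f x = covLap (ι a).η (ι a).U₀ (((ι a).Ω 0).indicator f) x) ∧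
        (∀ (μ : ℕ → Site θ.D → θ.𝔸), ∀ x ∈ (ι a).Ω 0, qs μ x = QT θ.L (ι a).k (ι a).Λ (ι a).U₀ μ x) ∧
        (∀ (f : Site θ.D → θ.𝔸) (n : ℕ), n ≤ (ι a).k → ∀ y ∈ (ι a).Λ n, q f n y = QprimeIter (zdBlocking θ.D θ.L) (bgT θ.L (ι a).U₀) n f y) ∧
        (∀ (f : Site θ.D → θ.𝔸) (n : ℕ) (y : Site θ.D), ¬ (n ≤ (ι a).k ∧ y ∈ (ι a).Λ n) → q f n y = 0) ∧
        (∀ (X : XSpace θ.D (ι a).k θ.𝔸) (x : Site θ.D), ‖H' X x‖ ≤ B₀'H * ‖X‖) ∧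
        (∀ n, n ≤ (ι a).k → ∀ (X : XSpace θ.D (ι a).k θ.𝔸), ∀ p ∈ {b : Site θ.D × Fin θ.D | SideTouches ((ι a).Ω n) b.1 b.2},
          wt θ.L (ι a).η n * ‖covDerivFwd (ι a).η (ι a).U₀ p.2 (H' X) p.1‖ ≤ B₀'H * ‖X‖) ∧
        (∀ X : XSpace θ.D (ι a).k θ.𝔸, Bd2 θ.L (ι a).η (ι a).k (ι a).Ω (covLap (ι a).η (ι a).U₀ (H' X)) (B₂' * ‖X‖)) ∧
        (∀ (Y : XSpace θ.D (ι a).k θ.𝔸) (n : ℕ) (hn : n ≤ (ι a).k) (y : Site θ.D), y ∈ (ι a).Λ n →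
          QprimeIter (zdBlocking θ.D θ.L) (bgT θ.L (ι a).U₀) n (H' Y) y = Y (⟨n, Nat.lt_succ_of_le hn⟩, y)) ∧
        (∀ (f : Site θ.D → θ.𝔸) (r : ℝ), 0 ≤ r → Bd2 θ.L (ι a).η (ι a).k (ι a).Ω f r →
          (∀ x, ‖g f x‖ ≤ BG * r) ∧ ∀ n, n ≤ (ι a).k → ∀ p ∈ {b : Site θ.D × Fin θ.D | SideTouches ((ι a).Ω n) b.1 b.2},
            wt θ.L (ι a).η n * ‖covDerivFwd (ι a).η (ι a).U₀ p.2 (g f) p.1‖ ≤ BG * r) ∧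
        (∀ (f : Site θ.D → θ.𝔸) (r : ℝ), 0 ≤ r → Bd2 θ.L (ι a).η (ι a).k (ι a).Ω f r →
          Bd2 θ.L (ι a).η (ι a).k (ι a).Ω (f - g (qs (c (q (g f))))) (BR * r)))
    -- THEOREM 8's SOCKET-SIDE constants (source threshold `cP3`, source size factor `γ₈`, remainder slacks `γ′ γ″ γβ`) and the guard `2 ≤ 5dLB₀` on [4]'s `B₀` —
    -- NO layer equation, NO auxiliary `B₈ ∕ B₈β`, NO free-constant guard: those are CHOSEN ∕ DERIVED in the proof
    {cP3 γ₈ γ' γ'' γβ : ℝ} (hcP3 : 0 < cP3) (hγ₈ : 1 ≤ γ₈) (hγ' : 0 ≤ γ') (hγ'' : 0 ≤ γ'')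
    (hB : 2 ≤ 5 * (θ.D : ℝ) * θ.L * B₀) (hB₀β : 0 < B₀β)
    -- [Balaban1985BackgroundPropagators] Thm 3.3 WITH SOURCE in Theorem 4's frame at (1.146), γ′ letter, at the law members ONLY, asked RADIUS-UNIFORMLY: for every
    -- gauge-field radius scale `r ≥ 0` SOME threshold `c59 > 0` (print needs the one radius `r = O(B₁)`; [4] Thm 3.3 gives every `r` by shrinking its threshold) — HYPOTHESIS
    (SH59src : ∀ r : ℝ, 0 ≤ r → ∃ c59 : ℝ, 0 < c59 ∧ ∀ i : ZdIdx θ.D θ.L, i.Ω 0 = Set.univ → IdxB8LawsB θ.L i → B8ConstraintBonds.DomainSeq θ.L i.Ω → ∀ α₀ α₁ : ℝ, 0 < α₀ → 0 < α₁ → α₀ + α₁ ≤ c59 →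
      ∀ U₀ U' : Site θ.D → Fin θ.D → θ.𝔸ˣ, (∀ x κ, U₀ x κ ∈ unitaryUnits θ.𝔸) → (∀ x κ, U' x κ ∈ unitaryUnits θ.𝔸) →
      ∀ φ : Site θ.D → θ.𝔸, ((InR138 θ.L i.k i.η (i.Ω 0) (i.Λs i.k) U₀ φ ∧ (∀ x, IsSelfAdjoint (φ x)) ∧ (∀ x, x ∉ i.Ω 0 → φ x = 0) ∧
          Bdd θ.L i.k i.η (-(2 : ℝ)) (fun j (x : Site θ.D) => x ∈ i.Ω j) φ) ∧
        msup θ.L i.k i.η (-(2 : ℝ)) (fun j (x : Site θ.D) => x ∈ i.Ω j) φ < γ₈ * (α₀ + α₁)) →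
      InAk θ.L i.k i.η α₀ i.Ω U₀ → InAk θ.L i.k i.η α₀ i.Ω (mulCfg U' U₀) → (∀ m, m ≤ i.k → InAx θ.L m (i.Λs m) U₀ (mulCfg U' U₀)) →
      (∀ j, j ≤ i.k → ∀ (z : Site θ.D) (μ : Fin θ.D),
        ((∀ x, InBox (tlo θ.L z j) (thi θ.L z j) x → x ∈ i.Ω j) ∨ (∀ x, InBox (tlo θ.L (z + e μ) j) (thi θ.L (z + e μ) j) x → x ∈ i.Ω j)) →
        ‖(avgIter θ.L (mulCfg U' U₀) j z μ : θ.𝔸) - (avgIter θ.L U₀ j z μ : θ.𝔸)‖ ≤ α₁) →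
      (∀ b ∈ {b : Site θ.D × Fin θ.D | SideTouches (i.Ω 0) b.1 b.2}, ‖((U' b.1 b.2 : θ.𝔸ˣ) : θ.𝔸) - 1‖ ≤ α₁) →
      (∀ m, 1 ≤ m → m ≤ i.k → ∀ (u : Site θ.D → θ.𝔸ˣ) (W : Site θ.D → Fin θ.D → θ.𝔸ˣ) (A' : Site θ.D → Fin θ.D → θ.𝔸),
        (∀ x, u x ∈ unitaryUnits θ.𝔸) → mgauge U₀ u W = U' → Restr129 θ.L m (i.Λs m) U₀ u → LanF146 θ.L i.k i.η (i.Ω 0) i.Λs U₀ φ m W →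
        (∀ y τ, IsSelfAdjoint (A' y τ)) →
        (∀ j, j ≤ m → ∀ y τ, SideTouches (i.Ω j) y τ →
        W y τ = cfgExp i.η A' y τ ∧ ‖A' y τ‖ ≤ r * (α₀ + α₁) * ((θ.L : ℝ) ^ j * i.η)⁻¹) →
        (∀ y τ, (∀ j, j ≤ m → ¬ SideTouches (i.Ω j) y τ) → A' y τ = 0) →
        msup θ.L m i.η (-(1 : ℝ)) (fun j (b : Site θ.D × Fin θ.D) => SideTouches (i.Ω j) b.1 b.2) (fun b => A' b.1 b.2)
        ≤ B₀ * (bondNorm θ.L m i.η (-(3 : ℝ)) i.Ω (fun x μ => Jcur i.η U₀ A' μ x)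
        + wsup 1 (fun p : {p : ℕ × (Site θ.D × Fin θ.D) // p.1 ≤ m ∧ p.2 ∈ towerBondsP θ.L i.Ω (i.Λs m) p.1} =>
        linCovIter θ.L U₀ (iEta i.η A') p.1.1 p.1.2.1 p.1.2.2)) + γ' * B₀ * (α₀ + α₁) ∧
        msup θ.L m i.η (-(2 : ℝ)) (fun j (t : Fin θ.D × Fin θ.D × Site θ.D) => SideTouches (i.Ω j) t.2.2 t.2.1)
        (fun t => covDerivFwd i.η U₀ t.1 (fun z => A' z t.2.1) t.2.2)
        ≤ B₀ * (bondNorm θ.L m i.η (-(3 : ℝ)) i.Ω (fun x μ => Jcur i.η U₀ A' μ x)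
        + wsup 1 (fun p : {p : ℕ × (Site θ.D × Fin θ.D) // p.1 ≤ m ∧ p.2 ∈ towerBondsP θ.L i.Ω (i.Λs m) p.1} =>
        linCovIter θ.L U₀ (iEta i.η A') p.1.1 p.1.2.1 p.1.2.2)) + γ' * B₀ * (α₀ + α₁)))
    -- THE SOURCED b9 SOCKET OF PROPOSITION 3's FRAME at the `Ω₀ = ℤᵈ` law members, threshold `cP3`, `|B₁|` over print's class at the top truncation — HYPOTHESIS
    -- ([Balaban1985BackgroundPropagators] Thm 3.3 with source; = `B8Prop3SrcZd3HPGamma`'s input letter for letter)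
    (SB9srcHP : ∀ i : ZdIdx θ.D θ.L, i.Ω 0 = Set.univ → IdxB8LawsB θ.L i → B8ConstraintBonds.DomainSeq θ.L i.Ω → ∀ α₀ α₁ α₂ : ℝ, 0 < α₀ → α₀ ≤ cP3 → 0 < α₁ → 0 < α₂ → α₂ ≤ cP3 →
      ∀ (U₀ W : Site θ.D → Fin θ.D → θ.𝔸ˣ), (∀ x κ, U₀ x κ ∈ unitaryUnits θ.𝔸) → (∀ x κ, W x κ ∈ unitaryUnits θ.𝔸) →
      ∀ f : Site θ.D → θ.𝔸, InR138 θ.L i.k i.η (i.Ω 0) (i.Λs i.k) U₀ f →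
      (∀ x, IsSelfAdjoint (f x)) → (∀ x, x ∉ i.Ω 0 → f x = 0) →
      Bdd θ.L i.k i.η (-(2 : ℝ)) (fun j (x : Site θ.D) => x ∈ i.Ω j) f →
      msup θ.L i.k i.η (-(2 : ℝ)) (fun j (x : Site θ.D) => x ∈ i.Ω j) f < γ₈ * (α₀ + α₁) →
      msup θ.L i.k i.η (-(3 : ℝ)) (fun j (p : Fin θ.D × Site θ.D) => p.2 ∈ i.Ω j) (fun p => covDerivFwd i.η U₀ p.1 f p.2) < γ₈ * (α₀ + α₁) →
      InAk θ.L i.k i.η α₀ i.Ω U₀ → InAk θ.L i.k i.η α₀ i.Ω (mulCfg W U₀) → IsLandau146W θ.L i.k i.η (i.Ω 0) (i.Λs i.k) U₀ f W →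
      ∀ A' : Site θ.D → Fin θ.D → θ.𝔸, (∀ y τ, IsSelfAdjoint (A' y τ)) →
      (∀ j, j ≤ i.k → ∀ (y : Site θ.D) (τ : Fin θ.D), SideTouches (i.Ω j) y τ →
        W y τ = cfgExp i.η A' y τ ∧ ‖A' y τ‖ ≤ α₂ * ((θ.L : ℝ) ^ j * i.η)⁻¹) →
      (∀ (y : Site θ.D) (τ : Fin θ.D), (∀ j, j ≤ i.k → ¬ SideTouches (i.Ω j) y τ) → A' y τ = 0) →
      msup θ.L i.k i.η (-(1 : ℝ)) (fun j (b : Site θ.D × Fin θ.D) => SideTouches (i.Ω j) b.1 b.2) (fun b => A' b.1 b.2)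
          ≤ B₀ * (bondNorm θ.L i.k i.η (-(3 : ℝ)) i.Ω (fun x μ => Jcur i.η U₀ A' μ x)
            + wsup 1 (fun p : {p : ℕ × (Site θ.D × Fin θ.D) // p.1 ≤ i.k ∧ p.2 ∈ towerBondsP θ.L i.Ω (i.Λs i.k) p.1} =>
                linCovIter θ.L U₀ (iEta i.η A') p.1.1 p.1.2.1 p.1.2.2)) + γ'' * B₀ * (α₀ + α₁) ∧
        msup θ.L i.k i.η (-(2 : ℝ)) (fun j (t : Fin θ.D × Fin θ.D × Site θ.D) => SideTouches (i.Ω j) t.2.2 t.2.1)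
            (fun t => covDerivFwd i.η U₀ t.1 (fun z => A' z t.2.1) t.2.2)
          ≤ B₀ * (bondNorm θ.L i.k i.η (-(3 : ℝ)) i.Ω (fun x μ => Jcur i.η U₀ A' μ x)
            + wsup 1 (fun p : {p : ℕ × (Site θ.D × Fin θ.D) // p.1 ≤ i.k ∧ p.2 ∈ towerBondsP θ.L i.Ω (i.Λs i.k) p.1} =>
                linCovIter θ.L U₀ (iEta i.η A') p.1.1 p.1.2.1 p.1.2.2)) + γ'' * B₀ * (α₀ + α₁) ∧
        bondNorm θ.L i.k i.η (-(3 : ℝ)) i.Ω (fun x μ => pdiv i.η U₀ (plaqCovDeriv i.η U₀ A') μ x)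
          ≤ B₀ * (bondNorm θ.L i.k i.η (-(3 : ℝ)) i.Ω (fun x μ => Jcur i.η U₀ A' μ x)
            + wsup 1 (fun p : {p : ℕ × (Site θ.D × Fin θ.D) // p.1 ≤ i.k ∧ p.2 ∈ towerBondsP θ.L i.Ω (i.Λs i.k) p.1} =>
                linCovIter θ.L U₀ (iEta i.η A') p.1.1 p.1.2.1 p.1.2.2)) + γ'' * B₀ * (α₀ + α₁) ∧
        bondNorm θ.L i.k i.η (-(3 : ℝ)) i.Ω (fun x μ => covLap i.η U₀ (fun z => A' z μ) x)
          ≤ B₀ * (bondNorm θ.L i.k i.η (-(3 : ℝ)) i.Ω (fun x μ => Jcur i.η U₀ A' μ x)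
            + wsup 1 (fun p : {p : ℕ × (Site θ.D × Fin θ.D) // p.1 ≤ i.k ∧ p.2 ∈ towerBondsP θ.L i.Ω (i.Λs i.k) p.1} =>
                linCovIter θ.L U₀ (iEta i.η A') p.1.1 p.1.2.1 p.1.2.2)) + γ'' * B₀ * (α₀ + α₁) ∧
        msup θ.L i.k i.η (-(2 + β)) (fun j (q : Fin θ.D × Fin θ.D × (Site θ.D × Site θ.D)) => q.2.2 ∈ AdmPair i.η len ∧ q.2.2.1 ∈ i.Ω j ∧ q.2.2.2 ∈ i.Ω j)
            (fun q => hquot i.η β len U₀ (covDerivFwd i.η U₀ q.1 (fun z => A' z q.2.1)) q.2.2)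
          ≤ B₀β * (bondNorm θ.L i.k i.η (-(3 : ℝ)) i.Ω (fun x μ => Jcur i.η U₀ A' μ x)
            + wsup 1 (fun p : {p : ℕ × (Site θ.D × Fin θ.D) // p.1 ≤ i.k ∧ p.2 ∈ towerBondsP θ.L i.Ω (i.Λs i.k) p.1} =>
                linCovIter θ.L U₀ (iEta i.η A') p.1.1 p.1.2.1 p.1.2.2)) + γβ * (α₀ + α₁)) :
    ∃ lam : ResidB8 θ, B8LeafOfRecordSubBP₂C θ lam := by
  -- Proposition 6 AS PRINTED on print's cube class, θ-level (p596570): big block `ρ₀`, constants `B₁⋆ > 0`, `c₁⋆`, monotone in `(B₁, c₁)`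
  obtain ⟨ρ₀, B₁s, c₁s, -, -, hB₁s, -, hP6⟩ := prop6Printed_zdCubP_γ_holds_record_dvd θ hD hL5 (t := 1) le_rfl
  -- positivity bookkeeping on `d`, `L`, `B₀`, `K := 3(2dL²)·BG·BR`
  have hD' : (2 : ℝ) ≤ θ.D := by exact_mod_cast hD
  have hL' : (5 : ℝ) ≤ θ.L := by exact_mod_cast hL5
  obtain ⟨hDL1, hDL⟩ := fiveDL_bounds hD' hL'
  have hE : (1 : ℝ) ≤ 1 + 11 * (θ.D : ℝ) ^ 2 := le_add_of_nonneg_right (mul_nonneg (by norm_num) (sq_nonneg _))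
  have hB₀ : 0 < B₀ := pos_of_two_le_mul hDL hB
  have hK0 : 0 ≤ 3 * (2 * (θ.D : ℝ) * (θ.L : ℝ) ^ 2) * BG * BR :=
    mul_nonneg (mul_nonneg (mul_nonneg (by norm_num) (mul_nonneg (mul_nonneg (by norm_num) (le_trans (by norm_num) hD')) (sq_nonneg _))) hBG) hBR
  -- Theorem 8's auxiliary constants `B₈`, `B₈(β₀)`, CHOSEN
  obtain ⟨B₈, hB₈0, hB₀8, hγ8le, hγB, hγB'', hB₁sE⟩ := exists_B₈ hDL1 hE hB₀ hγ₈ hγ' hγ'' hB₁s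
  obtain ⟨B₈β, hB8β⟩ := exists_B₈β (B₀β := B₀β) (γ'' := γ'') (B₀ := B₀) (γβ := γβ) hDL
  -- THE RESIDUAL LAYER, CHOSEN: [4]'s `B₀`, `B₀′ := 2K + 1`, the Hölder data, Theorem 8's layer constants, Proposition 3's `C₂`; Prop-5∕6 carriers and the axial map are
  -- placeholders (re-pointed by `cutSubBP`, resp. unread by the «P₂C» slot, which pins print's tower axial map)
  obtain ⟨lam, hB₀', rfl, rfl, rfl, rfl, hC₂eq, hB₁', hB₁eq, hB₂eq⟩ : ∃ lam : ResidB8 θ,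
      lam.inp.B₀' = 2 * (3 * (2 * (θ.D : ℝ) * (θ.L : ℝ) ^ 2) * BG * BR) + 1 ∧ lam.inp.B₀ = B₀ ∧ lam.B₀β = B₀β ∧ lam.β = β ∧ lam.len = len ∧
        lam.C₂ = 2097152 * ((θ.D : ℝ) + 1) ^ 2 * (θ.L : ℝ) ^ 2 ∧ lam.B₁' = 5 * (θ.D : ℝ) * θ.L * B₈ ∧
        lam.B₁ = 5 * (θ.D : ℝ) * θ.L * B₈ * (1 + 11 * (θ.D : ℝ) ^ 2) ∧ lam.B₂ = 5 * (θ.D : ℝ) * θ.L * B₈β * (1 + 11 * (θ.D : ℝ) ^ 2) :=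
    ⟨{ β := β, len := len, I8c := PEmpty, lan := fun i => i.elim, I8d := PEmpty, cub := fun i => i.elim, toAxial := fun _ _ U => U,
       inp := ⟨B₀, 2 * (3 * (2 * (θ.D : ℝ) * (θ.L : ℝ) ^ 2) * BG * BR) + 1, hB₀, add_pos_of_nonneg_of_pos (mul_nonneg zero_le_two hK0) one_pos⟩,
       C₂ := 2097152 * ((θ.D : ℝ) + 1) ^ 2 * (θ.L : ℝ) ^ 2, B₁' := 5 * (θ.D : ℝ) * θ.L * B₈,
       B₁ := 5 * (θ.D : ℝ) * θ.L * B₈ * (1 + 11 * (θ.D : ℝ) ^ 2), B₂ := 5 * (θ.D : ℝ) * θ.L * B₈β * (1 + 11 * (θ.D : ℝ) ^ 2), c₁ := 0, B₀β := B₀β },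
      rfl, rfl, rfl, rfl, rfl, rfl, rfl, rfl, rfl⟩
  -- the two free-constant guards and the dial, DERIVED
  obtain ⟨hfree2, hfreeS⟩ : 3 * (2 * (θ.D : ℝ) * (θ.L : ℝ) ^ 2) * BG * BR ≤ lam.inp.B₀' / 2 ∧
      3 * (2 * (θ.D : ℝ) * (θ.L : ℝ) ^ 2) * BG * BR * (B₈ + γ₈) ≤ lam.inp.B₀' * B₈ := by
    rw [hB₀']; exact free_guards hK0 hγ8le hB₈0
  have hB₁big : B₁s ≤ lam.B₁ := hB₁eq ▸ hB₁sE
  -- [4] Thm 3.3 with source at Theorem 8's gauge-field radius `2L·5dLB₈ + 64B₀′·5dLB₈`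
  obtain ⟨c59, hc59, SH⟩ := SH59src (2 * (θ.L * (5 * (θ.D : ℝ) * θ.L * B₈)) + 8 * (8 * lam.inp.B₀' * (5 * (θ.D : ℝ) * θ.L * B₈)))
    (radius_nonneg (le_trans (by norm_num) hL') hDL.le hB₈0 lam.inp.B₀'_pos.le)
  -- ONE `exact`: p606531 at the chosen layer's print-class cut, its radius line re-associated by `ring`
  exact ⟨lam.cutSubBP J (fun a : J => zdLan θ.L lam.B₁ (ι a)) c₁s ρ₀,
    b8LeafOfRecordSubBP₂C_cutSubBP_zdLan_printCube_of_knit_lettersSrc_γ' lam hD hC₂eq hcB9 hB₀'H hB₂' hBG hBR hcL SLet SLetUB SB9P hfree2 ι hΩ0L hΩL htowerL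
      SLetL SLetLU hP6 hB₁big hc59 hcP3 hγ₈ hγ' hγ'' hB hB₀β hB₀8 hγB hγB'' hB8β hB₁' hB₁eq hB₂eq hfreeS
      (fun i hΩ hl hd α₀ α₁ hα₀ hα₁ hαc U₀ U' hU₀ hU' φ hφ hIn hIn' hAx h135 hbd m hm1 hmk u W A' hu hg hR hLan hsa hW hA0 =>
        SH i hΩ hl hd α₀ α₁ hα₀ hα₁ hαc U₀ U' hU₀ hU' φ hφ hIn hIn' hAx h135 hbd m hm1 hmk u W A' hu hg hR hLan hsa
          (fun j hj y τ hst => ⟨(hW j hj y τ hst).1, (hW j hj y τ hst).2.trans_eq (by ring)⟩) hA0)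
      SB9srcHP⟩

end SlotExists

section Layer

/-- ★ **THE CHOSEN RESIDUAL LAYER, EXPOSED** (the arithmetic of `exists_residB8_b8LeafOfRecordSubBP₂C_of_lettersSrc_γ'` packaged for the knits that name
Proposition 5's family themselves, e.g. `BalabanUVNodesN05SubBP2CSlotExistsLawLanGammaPrime`): for `2 ≤ θ.D`, `5 ≤ θ.L`, [4]'s `B₀` with `2 ≤ 5dLB₀`, `BG, BR ≥ 0`, the Hölder
data and Theorem 8's socket-side constants `γ₈ ≥ 1`, `γ′, γ″ ≥ 0`, `γβ`, THERE ARE Proposition 6's `(ρ₀, B₁⋆, c₁⋆)` (p596570, monotone clause), Theorem 8's auxiliary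
`B₈ ≥ max(B₀, 0)`, `B₈(β₀)` and a residual layer `lam` reading `B₀, B₀(β₀), β, len` with `C₂ = 2²¹(d+1)²L²`, `B₁′ = 5dLB₈`, `B₁ = 5dLB₈(1+11d²) ≥ B₁⋆`,
`B₂ = 5dLB₈(β₀)(1+11d²)`, the three slack guards, both free-constant guards at `lam.inp.B₀′`, and Theorem 8's gauge-field radius `2L·5dLB₈ + 64B₀′·5dLB₈ ≥ 0` — every
constant hypothesis of p606531's ★★★ except the sockets.  Bookkeeping only. [cite: Balaban1985RegularSpaces, Prop. 3 p.87, Prop. 5 p.94, Prop. 6 p.99, Thm 8 (1.146) p.101 (shape of the constants)] -/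
theorem exists_residB8_layer (θ : Stage3Params) (hD : 2 ≤ θ.D) (hL5 : 5 ≤ θ.L) {B₀ B₀β β : ℝ} {len : Site θ.D → ℝ} {BG BR : ℝ} (hBG : 0 ≤ BG) (hBR : 0 ≤ BR)
    {γ₈ γ' γ'' : ℝ} (γβ : ℝ) (hγ₈ : 1 ≤ γ₈) (hγ' : 0 ≤ γ') (hγ'' : 0 ≤ γ'') (hB : 2 ≤ 5 * (θ.D : ℝ) * θ.L * B₀) :
    ∃ (ρ₀ : ℕ) (B₁s c₁s B₈ B₈β : ℝ) (lam : ResidB8 θ),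
      (∀ {ι : Type} (f : ι → ZdIdx θ.D θ.L) (B₁'' c₁'' : ℝ), B₁s ≤ B₁'' → c₁'' ≤ c₁s →
          B8.Prop6Printed θ.D (θ.L : ℝ) B₁'' c₁'' (fun j => zdCubP θ.𝔸 θ.L ρ₀ (f j))) ∧
      lam.inp.B₀ = B₀ ∧ lam.B₀β = B₀β ∧ lam.β = β ∧ lam.len = len ∧ lam.C₂ = 2097152 * ((θ.D : ℝ) + 1) ^ 2 * (θ.L : ℝ) ^ 2 ∧
      lam.B₁' = 5 * (θ.D : ℝ) * θ.L * B₈ ∧ lam.B₁ = 5 * (θ.D : ℝ) * θ.L * B₈ * (1 + 11 * (θ.D : ℝ) ^ 2) ∧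
      lam.B₂ = 5 * (θ.D : ℝ) * θ.L * B₈β * (1 + 11 * (θ.D : ℝ) ^ 2) ∧ B₁s ≤ lam.B₁ ∧ 0 ≤ B₈ ∧ B₀ ≤ B₈ ∧
      5 * (θ.D : ℝ) * θ.L * B₀ + 2 * (γ' * B₀) ≤ 5 * (θ.D : ℝ) * θ.L * B₈ ∧ 5 * (θ.D : ℝ) * θ.L * B₀ + 2 * (γ'' * B₀) ≤ 5 * (θ.D : ℝ) * θ.L * B₈ ∧
      5 * (θ.D : ℝ) * θ.L * B₀β + 2 * B₀β * (γ'' * B₀) + γβ ≤ 5 * (θ.D : ℝ) * θ.L * B₈β ∧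
      3 * (2 * (θ.D : ℝ) * (θ.L : ℝ) ^ 2) * BG * BR ≤ lam.inp.B₀' / 2 ∧ 3 * (2 * (θ.D : ℝ) * (θ.L : ℝ) ^ 2) * BG * BR * (B₈ + γ₈) ≤ lam.inp.B₀' * B₈ ∧
      0 ≤ 2 * (θ.L * (5 * (θ.D : ℝ) * θ.L * B₈)) + 8 * (8 * lam.inp.B₀' * (5 * (θ.D : ℝ) * θ.L * B₈)) := by
  obtain ⟨ρ₀, B₁s, c₁s, -, -, hB₁s, -, hP6⟩ := prop6Printed_zdCubP_γ_holds_record_dvd θ hD hL5 (t := 1) le_rfl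
  have hD' : (2 : ℝ) ≤ θ.D := by exact_mod_cast hD
  have hL' : (5 : ℝ) ≤ θ.L := by exact_mod_cast hL5
  obtain ⟨hDL1, hDL⟩ := fiveDL_bounds hD' hL'
  have hE : (1 : ℝ) ≤ 1 + 11 * (θ.D : ℝ) ^ 2 := le_add_of_nonneg_right (mul_nonneg (by norm_num) (sq_nonneg _))
  have hB₀ : 0 < B₀ := pos_of_two_le_mul hDL hB
  have hK0 : 0 ≤ 3 * (2 * (θ.D : ℝ) * (θ.L : ℝ) ^ 2) * BG * BR :=
    mul_nonneg (mul_nonneg (mul_nonneg (by norm_num) (mul_nonneg (mul_nonneg (by norm_num) (le_trans (by norm_num) hD')) (sq_nonneg _))) hBG) hBR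
  obtain ⟨B₈, hB₈0, hB₀8, hγ8le, hγB, hγB'', hB₁sE⟩ := exists_B₈ hDL1 hE hB₀ hγ₈ hγ' hγ'' hB₁s
  obtain ⟨B₈β, hB8β⟩ := exists_B₈β (B₀β := B₀β) (γ'' := γ'') (B₀ := B₀) (γβ := γβ) hDL
  obtain ⟨hf2, hfS⟩ := free_guards hK0 hγ8le hB₈0
  have hB₀' : 0 < 2 * (3 * (2 * (θ.D : ℝ) * (θ.L : ℝ) ^ 2) * BG * BR) + 1 := add_pos_of_nonneg_of_pos (mul_nonneg zero_le_two hK0) one_pos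
  exact ⟨ρ₀, B₁s, c₁s, B₈, B₈β,
    { β := β, len := len, I8c := PEmpty, lan := fun i => i.elim, I8d := PEmpty, cub := fun i => i.elim, toAxial := fun _ _ U => U,
      inp := ⟨B₀, 2 * (3 * (2 * (θ.D : ℝ) * (θ.L : ℝ) ^ 2) * BG * BR) + 1, hB₀, hB₀'⟩,
      C₂ := 2097152 * ((θ.D : ℝ) + 1) ^ 2 * (θ.L : ℝ) ^ 2, B₁' := 5 * (θ.D : ℝ) * θ.L * B₈,
      B₁ := 5 * (θ.D : ℝ) * θ.L * B₈ * (1 + 11 * (θ.D : ℝ) ^ 2), B₂ := 5 * (θ.D : ℝ) * θ.L * B₈β * (1 + 11 * (θ.D : ℝ) ^ 2), c₁ := 0, B₀β := B₀β },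
    hP6, rfl, rfl, rfl, rfl, rfl, rfl, rfl, rfl, hB₁sE, hB₈0, hB₀8, hγB, hγB'', hB8β, hf2, hfS,
    radius_nonneg (le_trans (by norm_num) hL') hDL.le hB₈0 hB₀'.le⟩

end Layer

/-! ## SUPERSEDED — EX FALSO AS TYPED (v1.1 DOC-ONLY note, dag-n05-d g12, 2026-08-28; all declarations byte-identical)

dag-n05-w1's certificate `B8SockLettersRDIdxB8LawsBVacuity.sLet_idxB8LawsB_unsatisfiable_stage3 θ hcL SLet : False` (p613168) shows that the binder `SLet` (and `SLetUB`)
displayed by `exists_residB8_b8LeafOfRecordSubBP₂C_of_lettersSrc_γ'` (the ★★★ above) — [Balaban1985BackgroundPropagators]'s letters demanded at EVERY member of the class `Ω₀ = ℤᵈ ∧ IdxB8LawsB ∧ DomainSeq` — is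
UNSATISFIABLE: the class admits the all-`univ` datum `i⋆` (`Λs ≡ ⊤`, `k = 1`), at which `SockLettersRD`'s interpolation clause `Q′ⱼ(H′Y)(y) = Y(j,y)` over
`Λ₀ = Λ₁ = ℤᵈ` is contradictory.  Hence that theorem holds EX FALSO AS TYPED and certifies nothing; it is kept for the record and SUPERSEDED by its «P₂D» twin
`BalabanUVNodesN05SubBP2DSlotExistsLawLanGammaPrime.exists_residB8_b8LeafOfRecordSubBP₂D_cutSubBP₅_of_lettersSrc_γ'` (p619291), whose binders demand the letters only at the
(1.3)–(1.5)-ADMISSIBLE members (print's (1.5) `Λ_j = Ω_j^{(j)} ∖ Ω_{j+1}^{(j)}` conjoined as «`∀ l, l < i.k → ∀ z ∈ i.Λs i.k l, ((θ.L : ℤ) ^ l) • z ∈ B8ConstraintBonds.Lam θ.L i.Ω l`»,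
dag-n05-c's repair letter; the class then excludes `i⋆`, dag-n05-c `B8IdxB8LamTopTowerDisjoint.not_lamTop_allUniv`).  §Layer `exists_residB8_layer` carries NO socket binder and STANDS (it is the layer lemma the «P₂D» files use).
[cite: Balaban1985RegularSpaces, (1.5) p.77; Balaban1985BackgroundPropagators, Thm 3.1 p.397 (the letters' member class)] -/

end Summit.QuantumFields.YangMills.BalabanUVNodes.N05SubBP2CSlotExistsGammaPrime

end
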